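import Mathlib
import Literature.Probability.LatticeModels.GKSInequalities
import Summits.CriticalPhenomena.Ising3DConformalLimit.Theorems.PrecisionLaplacianInverseMFerromagnetImOfSp
import HarnessLib

/-!
# Crux `PrecisionLaplacian.InverseMFerromagnet` (stmt-CriticalPhenomena-4798), line `Sketch` —
# stub `helper_contraction_conditioning` (core E, E5: contraction = conditioning on agreement)

THEOREM-ONLY file (no definitions).  Three zero-field pair systems on the sites `Fin n` with bonds
`Fin m` enter the deletion–contraction pencil of the crux: the actual one `(K, C)`, the DELETED one
`(K⁰, C)` with `K⁰ i = if C i = {u,v} then 0 else K i`, and the CONTRACTED one `(K⁰, C¹)` with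
`C¹ i = if C i = {u,v} then {p,q} else (C i).image π`, `π z = if z = v then u else z` (the bonds at `v`
moved to `u`, the switched-off bonds re-supported on a dummy pair with coupling `0`, `v` isolated).

THEOREM (`helper_contraction_conditioning`).  For all sites `a, b`,
`⟨σ_{πa} σ_{πb}⟩_{(K⁰,C¹)} · ⟨1 + σ_uσ_v⟩_{(K⁰,C)} = ⟨σ_aσ_b (1 + σ_uσ_v)⟩_{(K⁰,C)}`: the contracted
system is the deleted system conditioned on `σ_u = σ_v`.

PROOF.  Write `ω̃ = Function.update ω v (ω u)` (the LIFT of `ω`: copy the spin at `u` onto `v`).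
(1) The contracted weight and the contracted observable only see `ω̃`:
`w¹(ω) = w⁰(ω̃)` termwise in the Hamiltonian (`ccc_gksWeight_contract`: a switched-off bond contributes
`0` on both sides; any other bond `{x,y} ≠ {u,v}` has `{πx, πy}` of cardinality two — `csp_contract_ne`
of the landed E3 module, imported — and `σ_{πx}(ω) = σ_x(ω̃)`), and `σ_{πa}(ω)σ_{πb}(ω) = σ_a(ω̃)σ_b(ω̃)`.
(2) The lift is two-to-one onto the configurations agreeing at `u, v`, which we use in the form
`∑_ω G(ω̃) = ∑_ω (1 + σ_uσ_v) G(ω)` (`ccc_sum_update`): pointwise `(1 + σ_uσ_v)G(ω̃) = (1 + σ_uσ_v)G(ω)`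
(the factor vanishes unless `ω u = ω v`, where `ω̃ = ω`), and `∑_ω σ_uσ_v G(ω̃) = 0` by the flip at `v`,
which reverses `σ_uσ_v` and fixes `ω̃`.
(3) Hence `Z¹⟨g∘~⟩¹ = Z⁰⟨g (1 + σ_uσ_v)⟩⁰` for every observable `g` (`ccc_gksSum_contract`); with `g = σ_aσ_b`
and `g = 1` the claim is `(B/A)·(A/Z) = B/Z`, where `A = Z¹ > 0`.
-/

namespace Summit.CriticalPhenomena.Ising3DConformalLimit.Cruxes.InverseMFerromagnet.PartialCovarianceLadder

open Literature.Probability.LatticeModels Finset Matrix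

noncomputable section

/-! ## The flip at `v` and the agreement weight `1 + σ_uσ_v` -/

/-- Reindexing a sum over configurations by the (involutive) flip at `v`. [folklore] -/
theorem ccc_sum_flip {n : ℕ} (v : Fin n) (g : SpinConfig (Fin n) → ℝ) :
    ∑ ω : SpinConfig (Fin n), g (fun z => if z = v then -ω z else ω z) = ∑ ω, g ω := by
  have hinv : Function.Involutive
      (fun (ω : SpinConfig (Fin n)) (z : Fin n) => if z = v then -ω z else ω z) := by
    intro ω
    funext z
    by_cases hz : z = v <;> simp [hz]
  exact Equiv.sum_comp hinv.toPerm g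

/-- The lift `ω ↦ update ω v (ω u)` does not see the spin at `v`: it is unchanged by the flip at `v`
(`u ≠ v`). [folklore] -/
theorem ccc_update_flip {n : ℕ} (u v : Fin n) (huv : u ≠ v) (ω : SpinConfig (Fin n)) :
    Function.update (fun z => if z = v then -ω z else ω z) v (ω u) = Function.update ω v (ω u) := by
  funext z
  by_cases hz : z = v
  · subst hz
    rw [Function.update_self, Function.update_self]
  · rw [Function.update_of_ne hz, Function.update_of_ne hz, if_neg hz]

/-- Under the flip at `v`, `σ_u` is unchanged (`u ≠ v`) and `σ_v` changes sign. [folklore] -/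
theorem ccc_spinAt_flip {n : ℕ} (u v : Fin n) (huv : u ≠ v) (ω : SpinConfig (Fin n)) :
    spinAt u (fun z => if z = v then -ω z else ω z) = spinAt u ω ∧
      spinAt v (fun z => if z = v then -ω z else ω z) = -spinAt v ω := by
  unfold spinAt
  dsimp only
  refine ⟨by rw [if_neg huv], ?_⟩
  rw [if_pos rfl, Units.val_neg, Int.cast_neg]

/-- The odd part of a lifted sum vanishes: `∑_ω σ_uσ_v G(ω̃) = 0`, `ω̃ = update ω v (ω u)`, by the flip
at `v`, which reverses `σ_uσ_v` and fixes `ω̃`. [folklore] -/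
theorem ccc_sum_odd_update {n : ℕ} (u v : Fin n) (huv : u ≠ v) (G : SpinConfig (Fin n) → ℝ) :
    ∑ ω : SpinConfig (Fin n), spinAt u ω * spinAt v ω * G (Function.update ω v (ω u)) = 0 := by
  obtain ⟨g, hg⟩ : ∃ g : SpinConfig (Fin n) → ℝ,
      ∀ ω, g ω = spinAt u ω * spinAt v ω * G (Function.update ω v (ω u)) := ⟨_, fun _ => rfl⟩
  have hodd : ∀ ω : SpinConfig (Fin n), g (fun z => if z = v then -ω z else ω z) = -g ω := by
    intro ω
    rw [hg, hg, if_neg huv, ccc_update_flip u v huv ω, (ccc_spinAt_flip u v huv ω).1,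
      (ccc_spinAt_flip u v huv ω).2]
    ring
  have hsum := ccc_sum_flip v g
  rw [Finset.sum_congr rfl fun ω _ => hodd ω, Finset.sum_neg_distrib] at hsum
  have h0 : ∑ ω, g ω = 0 := by linarith
  rw [← h0]
  exact Finset.sum_congr rfl fun ω _ => (hg ω).symm

/-- Pointwise, the agreement weight identifies `ω` with its lift:
`(1 + σ_uσ_v)G(ω̃) = (1 + σ_uσ_v)G(ω)` (the weight vanishes unless `ω u = ω v`, where `ω̃ = ω`). [folklore] -/
theorem ccc_proj_update {n : ℕ} (u v : Fin n) (ω : SpinConfig (Fin n)) (G : SpinConfig (Fin n) → ℝ) :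
    (1 + spinAt u ω * spinAt v ω) * G (Function.update ω v (ω u)) =
      (1 + spinAt u ω * spinAt v ω) * G ω := by
  by_cases h : ω u = ω v
  · rw [h, Function.update_eq_self]
  · have h0 : 1 + spinAt u ω * spinAt v ω = 0 := by
      unfold spinAt
      rcases Int.units_eq_one_or (ω u) with hu | hu <;>
        rcases Int.units_eq_one_or (ω v) with hv | hv
      · exact absurd (hu.trans hv.symm) h
      · rw [hu, hv]; norm_num
      · rw [hu, hv]; norm_num
      · exact absurd (hu.trans hv.symm) h
    rw [h0, zero_mul, zero_mul]

/-- **Lift = conditioning on agreement.**  `∑_ω G(ω̃) = ∑_ω (1 + σ_uσ_v) G(ω)` with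
`ω̃ = update ω v (ω u)`, `u ≠ v`: the lift is two-to-one onto the configurations agreeing at `u, v`.
[folklore] -/
theorem ccc_sum_update {n : ℕ} (u v : Fin n) (huv : u ≠ v) (G : SpinConfig (Fin n) → ℝ) :
    ∑ ω : SpinConfig (Fin n), G (Function.update ω v (ω u)) =
      ∑ ω, (1 + spinAt u ω * spinAt v ω) * G ω := by
  have h1 : ∀ ω : SpinConfig (Fin n), G (Function.update ω v (ω u)) =
      (1 + spinAt u ω * spinAt v ω) * G (Function.update ω v (ω u)) -
        spinAt u ω * spinAt v ω * G (Function.update ω v (ω u)) := fun ω => by ring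
  rw [Finset.sum_congr rfl fun ω _ => h1 ω, Finset.sum_sub_distrib, ccc_sum_odd_update u v huv G,
    sub_zero]
  exact Finset.sum_congr rfl fun ω _ => ccc_proj_update u v ω G

/-! ## The contracted system is the deleted system composed with the lift -/

/-- Spins of the images: `σ_{πx}(ω) = σ_x(ω̃)`, `π x = if x = v then u else x`,
`ω̃ = update ω v (ω u)`. [folklore] -/
theorem ccc_spinAt_contract {n : ℕ} (u v x : Fin n) (ω : SpinConfig (Fin n)) :
    spinAt (if x = v then u else x) ω = spinAt x (Function.update ω v (ω u)) := by
  unfold spinAt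
  by_cases hx : x = v
  · rw [if_pos hx, hx, Function.update_self]
  · rw [if_neg hx, Function.update_of_ne hx]

/-- Pair products of the images: `σ_{π(A)}(ω) = σ_A(ω̃)` for every pair `A ≠ {u,v}` (the two images are
distinct by `csp_contract_ne` of E3, module …ImOfSp). [folklore] -/
theorem ccc_spinProduct_contract {n : ℕ} (u v : Fin n) (A : Finset (Fin n)) (hA : A.card = 2)
    (hne : A ≠ {u, v}) (ω : SpinConfig (Fin n)) :
    spinProduct (A.image (fun z => if z = v then u else z)) ω =
      spinProduct A (Function.update ω v (ω u)) := by
  obtain ⟨x, y, hxy, rfl⟩ := Finset.card_eq_two.mp hA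
  unfold spinProduct
  rw [Finset.image_insert, Finset.image_singleton,
    Finset.prod_pair (csp_contract_ne x y u v hxy hne), Finset.prod_pair hxy,
    ccc_spinAt_contract u v x ω, ccc_spinAt_contract u v y ω]

/-- The contracted Boltzmann weight is the deleted weight of the lift: `w¹(ω) = w⁰(ω̃)` (a switched-off
bond contributes `0` on both sides; any other bond by `ccc_spinProduct_contract`). [folklore] -/
theorem ccc_gksWeight_contract {n m : ℕ} (K : Fin m → ℝ) (C : Fin m → Finset (Fin n))
    (hC : ∀ i, (C i).card = 2) (u v p q : Fin n) (ω : SpinConfig (Fin n)) :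
    gksWeight Finset.univ (fun i => if C i = {u, v} then 0 else K i)
        (fun i => if C i = {u, v} then ({p, q} : Finset (Fin n))
          else (C i).image (fun z => if z = v then u else z)) ω =
      gksWeight Finset.univ (fun i => if C i = {u, v} then 0 else K i) C
        (Function.update ω v (ω u)) := by
  unfold gksWeight gksHamiltonian
  congr 1
  refine Finset.sum_congr rfl fun i _ => ?_
  dsimp only
  by_cases h : C i = {u, v}
  · rw [if_pos h, zero_mul, zero_mul]
  · rw [if_neg h, if_neg h, ccc_spinProduct_contract u v (C i) (hC i) h ω]

/-- Unnormalised contracted expectations of lifted observables are deleted expectations against the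
agreement weight: `Z¹⟨g∘~⟩¹ = Z⁰⟨g·(1 + σ_uσ_v)⟩⁰`. [folklore] -/
theorem ccc_gksSum_contract {n m : ℕ} (K : Fin m → ℝ) (C : Fin m → Finset (Fin n))
    (hC : ∀ i, (C i).card = 2) (u v p q : Fin n) (huv : u ≠ v) (g : SpinConfig (Fin n) → ℝ) :
    gksSum Finset.univ (fun i => if C i = {u, v} then 0 else K i)
        (fun i => if C i = {u, v} then ({p, q} : Finset (Fin n))
          else (C i).image (fun z => if z = v then u else z))
        (fun ω => g (Function.update ω v (ω u))) =
      gksSum Finset.univ (fun i => if C i = {u, v} then 0 else K i) C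
        (fun ω => g ω * (1 + spinAt u ω * spinAt v ω)) := by
  unfold gksSum
  rw [Finset.sum_congr rfl fun ω _ => congrArg (fun t => g (Function.update ω v (ω u)) * t)
    (ccc_gksWeight_contract K C hC u v p q ω)]
  rw [ccc_sum_update u v huv
    (fun ω => g ω * gksWeight Finset.univ (fun i => if C i = {u, v} then 0 else K i) C ω)]
  exact Finset.sum_congr rfl fun ω _ => by ring

/-- **E5 · contraction = conditioning on agreement (infrastructure for E1).**  In the contracted system of `stub_sp` (bonds at `v`
moved to `u`, the bonds equal to `{u,v}` re-supported on `{p,q}` with coupling `0`, `v` isolated) the two-point function of the images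
equals the two-point function of the deleted system conditioned on `σ_u = σ_v`. [folklore] -/
theorem helper_contraction_conditioning :
    ∀ (n m : ℕ) (K : Fin m → ℝ) (C : Fin m → Finset (Fin n)), (∀ i, (C i).card = 2) →
      ∀ (u v p q : Fin n), u ≠ v → p ≠ v → q ≠ v → ∀ a b : Fin n,
        gksExpect Finset.univ (fun i => if C i = {u, v} then 0 else K i)
            (fun i => if C i = {u, v} then ({p, q} : Finset (Fin n))
              else (C i).image (fun z => if z = v then u else z))
            (fun ω => spinAt (if a = v then u else a) ω * spinAt (if b = v then u else b) ω) *
          gksExpect Finset.univ (fun i => if C i = {u, v} then 0 else K i) C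
            (fun ω => 1 + spinAt u ω * spinAt v ω) =
        gksExpect Finset.univ (fun i => if C i = {u, v} then 0 else K i) C
          (fun ω => spinAt a ω * spinAt b ω * (1 + spinAt u ω * spinAt v ω)) := by
  intro n m K C hC u v p q huv _ _ a b
  have hobs : (fun ω : SpinConfig (Fin n) =>
      spinAt (if a = v then u else a) ω * spinAt (if b = v then u else b) ω) =
      fun ω => spinAt a (Function.update ω v (ω u)) * spinAt b (Function.update ω v (ω u)) := by
    funext ω
    rw [ccc_spinAt_contract u v a ω, ccc_spinAt_contract u v b ω]
  have hN : gksSum Finset.univ (fun i => if C i = {u, v} then 0 else K i)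
      (fun i => if C i = {u, v} then ({p, q} : Finset (Fin n))
        else (C i).image (fun z => if z = v then u else z))
      (fun ω => spinAt a (Function.update ω v (ω u)) * spinAt b (Function.update ω v (ω u))) =
      gksSum Finset.univ (fun i => if C i = {u, v} then 0 else K i) C
        (fun ω => spinAt a ω * spinAt b ω * (1 + spinAt u ω * spinAt v ω)) :=
    ccc_gksSum_contract K C hC u v p q huv (fun ω => spinAt a ω * spinAt b ω)
  have hZ : gksSum Finset.univ (fun i => if C i = {u, v} then 0 else K i)
      (fun i => if C i = {u, v} then ({p, q} : Finset (Fin n))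
        else (C i).image (fun z => if z = v then u else z)) (fun _ => 1) =
      gksSum Finset.univ (fun i => if C i = {u, v} then 0 else K i) C
        (fun ω => 1 + spinAt u ω * spinAt v ω) := by
    rw [ccc_gksSum_contract K C hC u v p q huv (fun _ => 1)]
    exact congrArg _ (funext fun ω => one_mul _)
  have hpos := gksSum_one_pos Finset.univ (fun i => if C i = {u, v} then (0 : ℝ) else K i)
    (fun i => if C i = {u, v} then ({p, q} : Finset (Fin n))
      else (C i).image (fun z => if z = v then u else z))
  rw [hZ] at hpos
  unfold gksExpect
  rw [hobs, hN, hZ]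
  exact div_mul_div_cancel₀ hpos.ne'

end

end Summit.CriticalPhenomena.Ising3DConformalLimit.Cruxes.InverseMFerromagnet.PartialCovarianceLadder
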